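import Summits.Ventures.Crystal3D.Theorems.StickyWulffConstantNoReconstructionGainExactLocalReplication
import Summits.Ventures.Crystal3D.Theorems.StickyWulffConstantNoReconstructionGainGrainFilmSlab
import Summits.Ventures.Crystal3D.Theorems.StickyWulffConstantGenericWallFloorMixedDozenRules
import Summits.Ventures.Crystal3D.Theorems.StickyWulffConstantNoReconstructionGainExactClassReplication
import HarnessLib

/-!
# No criminal is a rigidly moved single-crystal fragment (line `replication-exactness`)

HONEST FRAMING. Part of the venture `Summits/Ventures/Crystal3D` (cell `crystal3d-full`), supports the
crux `NoReconstructionGain` (stmt-Ventures-19144, route `route-Ventures-StickyWulffConstant`), line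
`replication-exactness` (lead wulff-p1 g18).  First instantiation of the LOCAL replication licence
`not_isCriminal_of_localAtom` (`…ExactLocalReplication`) with a landed adhesion rung: the misoriented
grain rung `grainFilm_slab` (`…GrainFilmSlab`, g12: films off `Λ₀` whose unit bonds are lattice
vectors of ONE rotated frame `A Λ₀` gain at most `C ρ` over the slab sample, at every normal).  The
film property "off-lattice + bond registry in the frame `A`" is local (translation invariant, inherited
by far unions), so the licence applies verbatim.

* `not_isCriminal_of_grain` — for every linear isometry `A` and every face `H(ν,s)`: a film none of
  whose balls is a site of `Λ₀` and all of whose unit bonds `x − q` satisfy `A⁻¹(x − q) ∈ Λ₀` is not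
  a criminal;
* `not_isCriminal_of_subset_movedLattice` — in particular a film contained in a rigidly moved copy
  `A Λ₀ + x₀` of the fcc lattice and disjoint from `Λ₀` is never a criminal (EXACT₀ for arbitrarily
  misoriented / shifted single-crystal overgrowth, every face, no rationality assumption);
* `not_isCriminal_of_subset_coset` — a film inside ONE coset `x₀ + Λ₀` is never a criminal (if
  `x₀ ∈ Λ₀` this is the third-lattice theorem `not_isCriminal_of_subset_thirdLattice`).

WHAT THIS IS NOT: films meeting `Λ₀`, polycrystalline films, or films without bond registry are not
covered; the crux is not moved; rung F-C1 not moved.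
-/

noncomputable section

namespace Summit.Ventures.Crystal3D.Theorems

open Summit.Ventures.Crystal3D
open Literature.MathematicalPhysics.StatisticalMechanics (fccStacking contactDeficiency)
open scoped InnerProductSpace
open Finset

/-- **No criminal is a misoriented-grain film.**  For every linear isometry `A` of `ℝ³`, every unit
normal `ν` and cut `s`: a film none of whose balls lies on `Λ₀` and whose unit bonds all belong to the
rotated lattice `A Λ₀` is not a criminal on `H(ν,s)`. -/
theorem not_isCriminal_of_grain (A : EuclideanSpace ℝ (Fin 3) ≃ₗᵢ[ℝ] EuclideanSpace ℝ (Fin 3))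
    {ν : EuclideanSpace ℝ (Fin 3)} (hν : ‖ν‖ = 1) {s : ℝ} {Q : Finset (EuclideanSpace ℝ (Fin 3))}
    (hoff : ∀ q ∈ Q, q ∉ fccStacking 1 (Real.sqrt (2 / 3)))
    (hreg : ∀ q ∈ Q, ∀ x ∈ Q, dist q x = 1 → A.symm (x - q) ∈ fccStacking 1 (Real.sqrt (2 / 3))) :
    ¬ IsCriminal ν s Q := by
  classical
  obtain ⟨R, C, hR, h⟩ := grainFilm_slab
  refine not_isCriminal_of_localAtom
    (Pf := fun F => (∀ q ∈ F, q ∉ fccStacking 1 (Real.sqrt (2 / 3))) ∧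
      (∀ q ∈ F, ∀ x ∈ F, dist q x = 1 → A.symm (x - q) ∈ fccStacking 1 (Real.sqrt (2 / 3))))
    (C := C) ?_ ?_ hν hR ?_ ⟨hoff, hreg⟩
  · -- translation invariance
    rintro F ⟨h1, h2⟩ t ht
    refine ⟨fun q hq hqΛ => ?_, fun q hq x hx hd => ?_⟩
    · obtain ⟨q', hq', rfl⟩ := Finset.mem_image.1 hq
      have := fcc_sub_site_mem hqΛ ht
      rw [add_sub_cancel_right] at this
      exact h1 q' hq' this
    · obtain ⟨q', hq', rfl⟩ := Finset.mem_image.1 hq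
      obtain ⟨x', hx', rfl⟩ := Finset.mem_image.1 hx
      have e : x' + t - (q' + t) = x' - q' := by abel
      rw [e]
      rw [dist_add_right] at hd
      exact h2 q' hq' x' hx' hd
  · -- far unions
    intro T G hG hfar
    refine ⟨fun q hq => ?_, fun q hq x hx hd => ?_⟩
    · obtain ⟨t, ht, hqt⟩ := Finset.mem_biUnion.1 hq
      exact (hG t ht).1 q hqt
    · obtain ⟨t, ht, hqt⟩ := Finset.mem_biUnion.1 hq
      obtain ⟨t', ht', hxt⟩ := Finset.mem_biUnion.1 hx
      by_cases htt : t = t'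
      · subst htt
        exact (hG t ht).2 q hqt x hxt hd
      · have := hfar t ht t' ht' htt q hqt x hxt
        rw [hd] at this
        exact absurd this (lt_irrefl 1)
  · -- the atom: the grain rung with the twelve fcc slots as `U₀`
    intro ρ hρ X P hpack hPX hP hPf habove
    exact h fccSlots (fun d hd => ⟨mem_fcc_of_mem_fccSlots hd, norm_eq_one_of_mem_fccSlots hd⟩)
      (fun d hd => neg_mem_fccSlots hd) card_fccSlots A ν hν ρ hρ X P hpack hPX hP habove hPf.1 hPf.2

/-- **No criminal inside a rigidly moved fcc crystal.**  A film contained in `A Λ₀ + x₀` (`A` a linear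
isometry, `x₀` any shift) none of whose balls lies on `Λ₀` is not a criminal, on any face. -/
theorem not_isCriminal_of_subset_movedLattice
    (A : EuclideanSpace ℝ (Fin 3) ≃ₗᵢ[ℝ] EuclideanSpace ℝ (Fin 3)) (x₀ : EuclideanSpace ℝ (Fin 3))
    {ν : EuclideanSpace ℝ (Fin 3)} (hν : ‖ν‖ = 1) {s : ℝ} {Q : Finset (EuclideanSpace ℝ (Fin 3))}
    (hQ : ∀ q ∈ Q, A.symm (q - x₀) ∈ fccStacking 1 (Real.sqrt (2 / 3)))
    (hoff : ∀ q ∈ Q, q ∉ fccStacking 1 (Real.sqrt (2 / 3))) : ¬ IsCriminal ν s Q := by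
  refine not_isCriminal_of_grain A hν hoff fun q hq x hx _ => ?_
  have e : x - q = (x - x₀) - (q - x₀) := by abel
  rw [e, map_sub]
  exact fcc_sub_site_mem (hQ x hx) (hQ q hq)


/-- **No criminal inside one coset of `Λ₀`.**  A film contained in `x₀ + Λ₀` is not a criminal, on any
face (`x₀ ∉ Λ₀`: a shifted grain, disjoint from `Λ₀`; `x₀ ∈ Λ₀`: a lattice film, inside `(1/3)Λ₀`). -/
theorem not_isCriminal_of_subset_coset (x₀ : EuclideanSpace ℝ (Fin 3))
    {ν : EuclideanSpace ℝ (Fin 3)} (hν : ‖ν‖ = 1) {s : ℝ} {Q : Finset (EuclideanSpace ℝ (Fin 3))}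
    (hQ : ∀ q ∈ Q, q - x₀ ∈ fccStacking 1 (Real.sqrt (2 / 3))) : ¬ IsCriminal ν s Q := by
  by_cases hx₀ : x₀ ∈ fccStacking 1 (Real.sqrt (2 / 3))
  · refine not_isCriminal_of_subset_thirdLattice hν fun q hq => fcc_mem_thirdLattice ?_
    have := fcc_add_site_mem (hQ q hq) hx₀
    rwa [sub_add_cancel] at this
  · refine not_isCriminal_of_subset_movedLattice (LinearIsometryEquiv.refl ℝ _) x₀ hν
      (fun q hq => hQ q hq)
      fun q hq hqΛ => hx₀ ?_
    have := fcc_sub_site_mem hqΛ (hQ q hq)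
    rwa [sub_sub_cancel] at this

end Summit.Ventures.Crystal3D.Theorems

end
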